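import Summits.QuantumFields.BalabanUV.T4Continuum.Spine.NE1p.DressedTransportAssembled

/-!
# T⁴ programme, spine estimate NE1′ (node O3b/H2) — END-F″: THE CANONICAL SIZE ∕ RADIUS ∕ BUDGET DATA OF THE ASSEMBLED TRANSPORT
# LEAF, so that END-F′'s five EQUALITY binders (`hs1`, `hAsz_birth`, `hAsz_step`, `hrs_birth`, `hrs_step`) and `hrs_dec` disappear
# (swarm row S2 «END-F′ plumbing» of `t4/formal/NE1p/LEAVES.md`, supplier item S2b of the same seat)

Cell `pub-balaban`, sub-cell `t4`, BINDER-OWNERS row NE1′, NE1′ FORMALISATION SWARM `b2b-balaban-t4-ne1p-formalise-*`, leaf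
prover 01 (unit `b2b-balaban-t4-ne1p-formalise-leaf-01`); owner lineage t4-ne1p-p1 (skeleton `t4/skeletons/NE1p-t4-ne1p-p1.md`
v1.1 §6 seat S2); tree target `Summits/QuantumFields/BalabanUV/T4Continuum/Spine/NE1p/`; ADDITIVE — imports
`Spine/NE1p/DressedTransportAssembled` (END-F′ `transportLeaf_assembled`) ONLY; modifies nothing.

WHY.  END-F′ (`DressedTransportAssembled.transportLeaf_assembled`) carries, next to the wall binders, the Assembly's bookkeeping
functions `rs` (current slice radius of a generation), `Asz` (current slice size) and `s1` (function-level fresh budget of a met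
component) as FREE binders constrained by equalities «the instantiation defines» (`hrs_birth`/`hrs_step`/`hAsz_birth`/`hAsz_step`/
`hs1`).  These equalities DETERMINE the three functions from the data `(gen, s, c, Sg, δf, ϱ, r)` by a well-founded joint
recursion on the scale (`Asz` at `k+1` needs `s1` at `k`, `s1` at `k` needs `Asz` at `k`).  This file performs that recursion once:
* §1 [data] `rsOf r ϱ f k″ k` (`= r` at the generation's own scale, `= ϱ f k″ (k−1)` afterwards; `rsOf_birth`, `rsOf_succ`),
  `aszStep`/`s1Step`/`data` (one `ℕ`-recursion producing, at scale `k`, the sizes of all generations and the budgets of all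
  components), `aszOf`, `s1Of` with their defining equations `aszOf_birth`, `aszOf_succ`, `s1Of_eq` [arith].
* §2 **`transportLeaf_assembled_canonical`** — END-F″ [bookkeeping]: END-F′ with `rs := rsOf r ϱ`, `Asz := aszOf …`,
  `s1 := s1Of …`; the five equality binders are the lemmas of §1, and `hrs_dec` (`ϱ f k″ k < rs f k″ k`) becomes the two
  schedule inequalities `hϱ_birth : ϱ f k″ k″ < r`, `hϱ_succ : ϱ f k″ (k+1) < ϱ f k″ k` (the shrinking chart radii — F-5's schedule).
  What stays displayed: the wall binders of END-F (F-1 `hsl`, F-2 `hFn`/`h𝒢`/`hQ`, F-3 `hB`/`hE`, F-5 nesting/margins incl. the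
  cross-family ones and `hmargin` over `rsOf`, F-6 `hrate`/`hδf`/`hpairx`/`hδfw`/`hdefw`, F-7 `hdom`, F-8 `hlin`, F-9 positivity,
  measurability) + the K-free scalars `0 < r_* ≤ r`, `r_* ≤ ϱ`, `‖c b k‖·r ≤ m·r_*`.  Conclusion: VERBATIM the field type of
  `BookingLeaves.htr`, as END-F and END-F′.

HONEST FRAMING.  Rung (B)+1 bookkeeping on ONE finite four-torus of fixed physical size — NOT infinite volume, NOT a mass gap, NOT
OS on ℝ⁴, NOT the Clay problem, NOT summit progress.  NE1′ is NOT PRINTED and NOT PROVED; headline «L-T ⇐ F-1, F-2, F-3, F-5…F-9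
(+ the H2 dictionary `hQ` and K-free scalars)», never «NE1′ proved»; 0 binders are instantiated on Bałaban's densities; the data
defined here are bookkeeping functions of HYPOTHESISED inputs (generation sizes, margins, source factors, defects, radii), no
`def … : Prop`, nothing of [Balaban1989LargeFieldII] is asserted.  [folklore] kernel glue, 0 sorry, 0 citations used as
hypothesis-free facts.  Spine PROVED 0∕9 unchanged.  HONEST DEPENDENCY: continuum YM on T⁴ ⇐ BetaPertH ∧ nine spine estimates
(0/9 proved); BetaPertH ⇐ (D1) ∧ (D4) ∧ CAP+tail; G-an2-4 gates asym, D1 and NE2/3/4.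
-/

noncomputable section

namespace Summit.QuantumFields.BalabanUV.T4Continuum.NE1p.DressedTransportAssembledData

open MeasureTheory Set Metric Filter Finset
open scoped BigOperators
open Literature.MathematicalPhysics.QuantumFieldTheory.Balaban1983to89
open Literature.MathematicalPhysics.QuantumFieldTheory.Balaban1983to89.T4TermFormat
open Literature.MathematicalPhysics.QuantumFieldTheory.Balaban1983to89.T4TermFormat.Booking
open Literature.MathematicalPhysics.QuantumFieldTheory.Balaban1983to89.T4GatedBooking
open Literature.MathematicalPhysics.QuantumFieldTheory.Balaban1983to89.T4TrajectoryComparison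
open Literature.MathematicalPhysics.QuantumFieldTheory.Balaban1983to89.T4TrajectoryModulus
open Summit.QuantumFields.BalabanUV.T4Continuum.T4TrajectoryDensityDressed
open Summit.QuantumFields.BalabanUV.T4Continuum.NE1p.DressedRoot
open Summit.QuantumFields.BalabanUV.T4Continuum.NE1p.DressedTransportAssembled
open T4BirthChartTransport (GaugeInvariant BirthSlice RelGauge)
open T4BlockTransport (Fld NDir latMove latN latMove_zero)
open T4TrajectoryDensity

/-! ## §1 The canonical radius, size and budget functions [data] and their defining equations [arith] -/

section Data

variable {B : T4TermFormat.Booking}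

/-- **CURRENT SLICE RADIUS OF A GENERATION** [data]: the generation `(f, k″)` is born on the chart of radius `r`; after the
dressed step `k → k+1` (`k ≥ k″`) its slice lives on the chart radius `ϱ f k″ k` chosen for that step.  Bookkeeping only. [folklore] -/
def rsOf (r : ℝ) (ϱ : B.Birth → ℕ → ℕ → ℝ) (f : B.Birth) (k'' k : ℕ) : ℝ :=
  if k ≤ k'' then r else ϱ f k'' (k - 1)

/-- At (and formally before) the generation's own scale the radius is the birth radius `r`. [arith] [folklore] -/
theorem rsOf_of_le (r : ℝ) (ϱ : B.Birth → ℕ → ℕ → ℝ) (f : B.Birth) {k'' k : ℕ} (h : k ≤ k'') :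
    rsOf r ϱ f k'' k = r :=
  if_pos h

/-- `rs f k″ k″ = r` — END-F′'s `hrs_birth`. [arith] [folklore] -/
theorem rsOf_birth (r : ℝ) (ϱ : B.Birth → ℕ → ℕ → ℝ) (f : B.Birth) (k'' : ℕ) : rsOf r ϱ f k'' k'' = r :=
  if_pos le_rfl

/-- `rs f k″ (k+1) = ϱ f k″ k` for `k″ ≤ k` — END-F′'s `hrs_step`. [arith] [folklore] -/
theorem rsOf_succ (r : ℝ) (ϱ : B.Birth → ℕ → ℕ → ℝ) (f : B.Birth) {k'' k : ℕ} (h : k'' ≤ k) :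
    rsOf r ϱ f k'' (k + 1) = ϱ f k'' k := by
  unfold rsOf
  rw [if_neg (by omega), Nat.add_sub_cancel]

variable (gen : B.Birth → ℕ → ℝ) (s : B.Birth → ℕ → ℝ) (c : B.Birth → ℕ → ℂ) (Sg : ℕ → B.Birth → Finset (B.Birth × ℕ))
  (δf : B.Birth → ℕ → B.Birth × ℕ → ℝ) (rs : B.Birth → ℕ → ℕ → ℝ)

/-- One step of the size recursion at scale `k` [data]: a generation of scale `≥ k` has its birth size, an older one the previous
size times the step cost `e^{3(s + s1)}` of step `k−1` (`prev` = sizes and budgets at scale `k−1`). [folklore] -/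
def aszStep (k : ℕ) (prev : (B.Birth → ℕ → ℝ) × (B.Birth → ℝ)) : B.Birth → ℕ → ℝ :=
  fun f k'' => if k ≤ k'' then gen f k'' else Real.exp (3 * (s f (k - 1) + prev.2 f)) * prev.1 f k''

/-- The function-level fresh budget of every met component at scale `k` from the sizes `A` at scale `k` [data]:
`‖c b k‖·Σ_{p ∈ Sg k b} 4·A p / rs p k·δf b k p`. [folklore] -/
def s1Step (k : ℕ) (A : B.Birth → ℕ → ℝ) : B.Birth → ℝ :=
  fun b => ‖c b k‖ * ∑ p ∈ Sg k b, 4 * A p.1 p.2 / rs p.1 p.2 k * δf b k p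

/-- THE JOINT RECURSION ON THE SCALE [data]: at scale `k`, the sizes of all generations and the budgets of all components. [folklore] -/
def data : ℕ → (B.Birth → ℕ → ℝ) × (B.Birth → ℝ)
  | 0 => (aszStep gen s 0 (fun _ _ => 0, fun _ => 0), s1Step c Sg δf rs 0 (aszStep gen s 0 (fun _ _ => 0, fun _ => 0)))
  | k + 1 => (aszStep gen s (k + 1) (data k), s1Step c Sg δf rs (k + 1) (aszStep gen s (k + 1) (data k)))

/-- **CURRENT SLICE SIZE OF A GENERATION** [data]: `Asz f k″ k`. [folklore] -/
def aszOf (f : B.Birth) (k'' k : ℕ) : ℝ :=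
  (data gen s c Sg δf rs k).1 f k''

/-- **FUNCTION-LEVEL FRESH BUDGET OF A MET COMPONENT** [data]: `s1 b k`. [folklore] -/
def s1Of (b : B.Birth) (k : ℕ) : ℝ :=
  (data gen s c Sg δf rs k).2 b

/-- The budget component of the recursion is `s1Step` of the size component. [arith] [folklore] -/
theorem data_snd (k : ℕ) :
    (data gen s c Sg δf rs k).2 = s1Step c Sg δf rs k (data gen s c Sg δf rs k).1 := by
  cases k <;> rfl

/-- `s1 b k = ‖c b k‖·Σ_{p∈Sg k b} 4·Asz p.1 p.2 k / rs p.1 p.2 k·δf b k p` — END-F′'s `hs1`. [arith] [folklore] -/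
theorem s1Of_eq (b : B.Birth) (k : ℕ) :
    s1Of gen s c Sg δf rs b k =
      ‖c b k‖ * ∑ p ∈ Sg k b, 4 * aszOf gen s c Sg δf rs p.1 p.2 k / rs p.1 p.2 k * δf b k p := by
  unfold s1Of aszOf
  rw [data_snd]
  rfl

/-- At (and formally before) its own scale a generation has its birth size. [arith] [folklore] -/
theorem aszOf_of_le (f : B.Birth) {k'' k : ℕ} (h : k ≤ k'') : aszOf gen s c Sg δf rs f k'' k = gen f k'' := by
  unfold aszOf
  cases k with
  | zero =>
    show aszStep gen s 0 (fun _ _ => 0, fun _ => 0) f k'' = _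
    unfold aszStep
    rw [if_pos h]
  | succ k =>
    show aszStep gen s (k + 1) (data gen s c Sg δf rs k) f k'' = _
    unfold aszStep
    rw [if_pos h]

/-- `Asz f k″ k″ = gen f k″` — END-F′'s `hAsz_birth`. [arith] [folklore] -/
theorem aszOf_birth (f : B.Birth) (k'' : ℕ) : aszOf gen s c Sg δf rs f k'' k'' = gen f k'' :=
  aszOf_of_le gen s c Sg δf rs f le_rfl

/-- `Asz f k″ (k+1) = e^{3(s f k + s1 f k)}·Asz f k″ k` for `k″ ≤ k` — END-F′'s `hAsz_step`. [arith] [folklore] -/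
theorem aszOf_succ (f : B.Birth) {k'' k : ℕ} (h : k'' ≤ k) :
    aszOf gen s c Sg δf rs f k'' (k + 1) =
      Real.exp (3 * (s f k + s1Of gen s c Sg δf rs f k)) * aszOf gen s c Sg δf rs f k'' k := by
  unfold aszOf s1Of
  show aszStep gen s (k + 1) (data gen s c Sg δf rs k) f k'' = _
  unfold aszStep
  rw [if_neg (by omega), Nat.add_sub_cancel]

end Data

/-! ## §2 END-F″: the assembled transport leaf over the canonical data [bookkeeping] -/

section FunctionLevel

variable {B : T4TermFormat.Booking} {T : Trajectory B}
variable {R : Type*} [NormedRing R] [NormedAlgebra ℂ R] [MeasurableSpace R] {d : ℕ}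

/-- **END-F″ — THE TRANSPORT LEAF `htr` OF `BookingLeaves` OVER THE CANONICAL SIZE ∕ RADIUS ∕ BUDGET DATA** [bookkeeping]:
`DressedTransportAssembled.transportLeaf_assembled` (END-F′) with `rs := rsOf r ϱ`, `Asz := aszOf T.gen s c Sg δf (rsOf r ϱ)`,
`s1 := s1Of T.gen s c Sg δf (rsOf r ϱ)`; its equality binders `hs1`/`hAsz_birth`/`hAsz_step`/`hrs_birth`/`hrs_step` are §1's
lemmas and `hrs_dec` is read off the schedule inequalities `hϱ_birth : ϱ f k″ k″ < r`, `hϱ_succ : ϱ f k″ (k+1) < ϱ f k″ k`.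
Displayed binders: END-F's wall items (F-1 `hsl`; F-2 `hFn`/`h𝒢` and the H2 dictionary `hQ`; F-3 `hB`/`hE`; F-5 `hN1`/`hN2`/
`hdiam`/`hθ`/`hN1x`/`hN2cx`/`hmargin`/`hϱfloor`/`hϱ_birth`/`hϱ_succ`; F-6 `hrate`/`hdefw`/`hδf`/`hδfw`/`hpairx`; F-7 `hdom`; F-8
`hlin`; F-9 `hα`/`hr`/`hw`/`hcδ`/`hψ`/`hrstar`/`hrstar_r`/`hD`/`hϱ`/`hDμ`; measurability `hmeas`; invariance `hinv`; live
generations ⊆ live families `hSg`) and the ONE K-free scalar `hcm : ‖c b k‖·r ≤ m·r_*`.  NO `hP`, NO `hs`, NO `hbudget`, NO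
bookkeeping equalities.  Conclusion: EXACTLY the field `htr` of `BookingLeaves` (`C = 4c_δ/r`, `ρ i = ψ·α i`).  Nothing of
Bałaban's densities is asserted. [folklore] -/
theorem transportLeaf_assembled_canonical {Fn : B.Birth → ℕ → ℕ → Fld d R → ℂ}
    {rel : B.Birth → ℕ → ℕ → Fld d R → Fld d R → Prop} {𝒦 : B.Birth → ℕ → ℕ → Set (Fld d R)}
    {ref : B.Birth → ℕ → Fld d R → Fld d R} {base : B.Birth → ℕ → Fld d R → ℝ}
    {𝒜 𝒬 : B.Birth → ℕ → Fld d R → Fld d R → ℂ} {q : B.Birth → ℕ → Fld d R → ℂ}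
    {μ : B.Birth → ℕ → Measure (Fld d R)} {z₀ z₁ : B.Birth → ℕ → Fld d R} {D : B.Birth → ℕ → Set (Fld d R)}
    {defect : B.Birth → ℕ → ℕ → ℝ} {cδ ψ w r rstar m : ℝ} {s θ ϱ₁ : B.Birth → ℕ → ℝ} {α : ℕ → ℝ}
    {ϱ : B.Birth → ℕ → ℕ → ℝ} {S : ℕ → B.Birth → Finset B.Birth}
    {Sg : ℕ → B.Birth → Finset (B.Birth × ℕ)} {c : B.Birth → ℕ → ℂ} {δf : B.Birth → ℕ → B.Birth × ℕ → ℝ}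
    (hα : ∀ i, 0 ≤ α i) (hr : 0 < r) (hw : 0 < w) (hcδ : 0 ≤ cδ) (hψ : 0 ≤ ψ)
    (hrstar : 0 < rstar) (hrstar_r : rstar ≤ r)
    (hsl : ∀ (b : B.Birth) (k' : ℕ), B.birthScale b ≤ k' → k' ≤ B.K →
      RanBelow (budgetGate T s m S (4 * cδ / r) (fun i => ψ * α i)) k' →
      BirthSlice (Fn b k' k') latMove latN (𝒦 b k' k') w r (T.gen b k'))
    (hFn : ∀ (b : B.Birth) (k' k : ℕ), B.birthScale b ≤ k' → k' ≤ k → k + 1 ≤ B.K →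
      RanBelow (budgetGate T s m S (4 * cδ / r) (fun i => ψ * α i)) (k + 1) →
      ∀ U, Fn b k' (k + 1) U =
        wOp (expWeight (base b k) (𝒜 b k + 𝒬 b k)) (μ b k) (z₀ b k) U (fun z => Fn b k' k (U + z)))
    (h𝒢 : ∀ (b : B.Birth) (k' k : ℕ), B.birthScale b ≤ k' → k' ≤ k → k + 1 ≤ B.K →
      RanBelow (budgetGate T s m S (4 * cδ / r) (fun i => ψ * α i)) (k + 1) →
      ∀ U, (fun z => Fn b k' k (U + z)) ∈ BddClass ℂ (μ b k))
    (hD : ∀ b k, (D b k).Nonempty) (hϱ : ∀ b k' k, 0 < ϱ b k' k)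
    (hB : ∀ (b : B.Birth) (k' k : ℕ), B.birthScale b ≤ k' → k' ≤ k → k + 1 ≤ B.K →
      RanBelow (budgetGate T s m S (4 * cδ / r) (fun i => ψ * α i)) (k + 1) →
      RealBaseAt (ref b k) (base b k) (𝒜 b k) (μ b k) (𝒦 b k' (k + 1)))
    (hE : ∀ (b : B.Birth) (k' k : ℕ), B.birthScale b ≤ k' → k' ≤ k → k + 1 ≤ B.K →
      RanBelow (budgetGate T s m S (4 * cδ / r) (fun i => ψ * α i)) (k + 1) →
      ExponentSliceAt (ref b k) (𝒜 b k) (μ b k) latMove latN (𝒦 b k' (k + 1)) w (ϱ b k' k) (s b k))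
    (hQ : ∀ b k, (fun U z => 𝒬 b k U z - q b k U) =
      fun U z => c b k * ∑ p ∈ Sg k b, (Fn p.1 p.2 k (U + z) - Fn p.1 p.2 k (U + z₁ b k)))
    (hSg : ∀ k b, ∀ p ∈ Sg k b, p.1 ∈ S k b ∧ B.birthScale p.1 ≤ p.2 ∧ p.2 ≤ k)
    (hϱ_birth : ∀ (f : B.Birth) (k'' : ℕ), B.birthScale f ≤ k'' → ϱ f k'' k'' < r)
    (hϱ_succ : ∀ (f : B.Birth) (k'' k : ℕ), B.birthScale f ≤ k'' → k'' ≤ k → ϱ f k'' (k + 1) < ϱ f k'' k)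
    (hϱfloor : ∀ f k'' k, B.birthScale f ≤ k'' → k'' ≤ k → rstar ≤ ϱ f k'' k)
    (hmargin : ∀ (b : B.Birth) (k' k : ℕ), B.birthScale b ≤ k' → k' ≤ k →
      ϱ b k' k < ϱ₁ b k ∧ 0 < ϱ₁ b k ∧ ∀ p ∈ Sg k b, ϱ₁ b k ≤ rsOf r ϱ p.1 p.2 k)
    (hcm : ∀ b k, ‖c b k‖ * r ≤ m * rstar)
    (hδf : ∀ b k, ∀ p ∈ Sg k b, 0 ≤ δf b k p ∧ δf b k p ≤ cδ * ψ ^ (k - p.2))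
    (hδfw : ∀ b k, ∀ p ∈ Sg k b, δf b k p ≤ w)
    (hDμ : ∀ b k, ∀ᵐ z ∂μ b k, z ∈ D b k)
    (hN1 : ∀ (b : B.Birth) (k' k : ℕ), B.birthScale b ≤ k' → k' ≤ k → k + 1 ≤ B.K →
      ∀ z ∈ D b k, ∀ U ∈ 𝒦 b k' (k + 1), U + z ∈ 𝒦 b k' k)
    (hN2 : ∀ (b : B.Birth) (k' k : ℕ), B.birthScale b ≤ k' → k' ≤ k → k + 1 ≤ B.K →
      ∀ U₀ ∈ 𝒦 b k' (k + 1), ∀ p : NDir d R, latN p ≤ w → ∀ z' ∈ D b k, latMove U₀ p 1 + z' ∈ 𝒦 b k' k)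
    (hN1x : ∀ (b : B.Birth) (k' k : ℕ), B.birthScale b ≤ k' → k' ≤ k →
      ∀ p ∈ Sg k b, ∀ z ∈ D b k, ∀ U ∈ 𝒦 b k' (k + 1), U + z ∈ 𝒦 p.1 p.2 k)
    (hN2cx : ∀ (b : B.Birth) (k' k : ℕ), B.birthScale b ≤ k' → k' ≤ k →
      ∀ p ∈ Sg k b, ∀ U₀ ∈ 𝒦 b k' (k + 1), ∀ pd : NDir d R, 0 < latN pd → latN pd ≤ w →
        ∀ t ∈ tube (ϱ₁ b k / latN pd), latMove U₀ pd t + z₁ b k ∈ 𝒦 p.1 p.2 k)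
    (hpairx : ∀ (b : B.Birth) (k' k : ℕ), B.birthScale b ≤ k' → k' ≤ k →
      ∀ p ∈ Sg k b, ∀ U₀ ∈ 𝒦 b k' (k + 1), ∀ pd : NDir d R, 0 < latN pd → latN pd ≤ w →
        ∀ᵐ z ∂μ b k, ∀ t ∈ tube (ϱ₁ b k / latN pd),
          RelGauge (rel p.1 p.2 k) latMove latN (latMove U₀ pd t + z₁ b k) (latMove U₀ pd t + z) (δf b k p))
    (hdiam : ∀ b k, ∀ z ∈ D b k, ∀ z' ∈ D b k, ∀ x ν, ‖z x ν - z' x ν‖ ≤ θ b k)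
    (hθ : ∀ b k, 0 < θ b k ∧ θ b k ≤ w)
    (hdom : ∀ (b : B.Birth) (k' k : ℕ), B.birthScale b ≤ k' → k' ≤ k → k + 1 ≤ B.K →
      Real.exp 3 * (1 + 4 * θ b k / ϱ b k' k) ≤ α k)
    (hinv : ∀ b k' k, GaugeInvariant (rel b k' k) (Fn b k' k))
    (hmeas : ∀ (b f : B.Birth) (k'' k : ℕ) (U : Fld d R), AEStronglyMeasurable (fun z => Fn f k'' k (U + z)) (μ b k))
    (hdefw : ∀ b k' k, defect b k' k ≤ w)
    (hrate : ∀ (b : B.Birth) (k' k : ℕ), B.birthScale b ≤ k' → k' ≤ k → k ≤ B.K →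
      defect b k' k ≤ cδ * ψ ^ (k - k'))
    (hlin : ∀ (b : B.Birth) (k' k : ℕ), B.birthScale b ≤ k' → k' ≤ k → k ≤ B.K →
      RanBelow (budgetGate T s m S (4 * cδ / r) (fun i => ψ * α i)) k → ∀ ε > 0,
      ∃ U₀ ∈ 𝒦 b k' k, ∃ U₁ : Fld d R, RelGauge (rel b k' k) latMove latN U₀ U₁ (defect b k' k) ∧
        T.lin b k' k ≤ ‖Fn b k' k U₁ - Fn b k' k U₀‖ + ε) :
    T.TransportsFromVar (4 * cδ / r) (fun i => ψ * α i) (budgetGate T s m S (4 * cδ / r) (fun i => ψ * α i)) := by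
  -- the schedule inequalities give END-F′'s `hrs_dec` for the canonical radius
  have hrs_dec : ∀ (f : B.Birth) (k'' k : ℕ), B.birthScale f ≤ k'' → k'' ≤ k → ϱ f k'' k < rsOf r ϱ f k'' k := by
    intro f k'' k hf hk''
    rcases Nat.lt_or_eq_of_le hk'' with hlt | heq
    · obtain ⟨k₀, rfl⟩ : ∃ k₀, k = k₀ + 1 := ⟨k - 1, by omega⟩
      have hk₀ : k'' ≤ k₀ := Nat.lt_succ_iff.mp hlt
      rw [rsOf_succ r ϱ f hk₀]
      exact hϱ_succ f k'' k₀ hf hk₀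
    · subst heq
      rw [rsOf_birth]
      exact hϱ_birth f k'' hf
  exact transportLeaf_assembled (rs := rsOf r ϱ) (Asz := aszOf T.gen s c Sg δf (rsOf r ϱ))
    (s1 := s1Of T.gen s c Sg δf (rsOf r ϱ)) hα hr hw hcδ hψ hrstar hrstar_r hsl hFn h𝒢 hD hϱ hB hE hQ hSg
    (s1Of_eq T.gen s c Sg δf (rsOf r ϱ)) (aszOf_birth T.gen s c Sg δf (rsOf r ϱ)) (rsOf_birth r ϱ)
    (fun f k'' k _ hk => aszOf_succ T.gen s c Sg δf (rsOf r ϱ) f hk) (fun f k'' k _ hk => rsOf_succ r ϱ f hk)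
    hrs_dec hϱfloor hmargin hcm hδf hδfw hDμ hN1 hN2 hN1x hN2cx hpairx hdiam hθ hdom hinv hmeas hdefw hrate hlin

end FunctionLevel

end Summit.QuantumFields.BalabanUV.T4Continuum.NE1p.DressedTransportAssembledData

end
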